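import Literature.Analysis.FluidPDE.MikadoCascadeBlocks
import Literature.Analysis.FluidPDE.LacunarySmoothSeries
import HarnessLib

/-!
# The principal parts `v⁽¹⁾ = ∑_{k even} v_k + ∑_{k odd} v̄_k`, `v⁽²⁾ = ∑_{k odd} v_k + ∑_{k even} v̄_k`
# of Coiculescu–Palasek (Def. 3.10) and Prop. 3.13: (3.13a), (3.13b), smooth, mean zero, div-free

Analysis/FluidPDE support file (definitions with proved API; no named facts) on the discharge path of
the principal-parts hypothesis `hA` of
`Literature.Barriers.NavierStokesRegularity.CriticalDataSmoothNonuniqueness_of_principalParts_of_perturbationLe`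
(M. P. Coiculescu, S. Palasek, *Non-uniqueness of smooth solutions of the Navier–Stokes equations from
critical data*, Invent. Math. 244 (2025), arXiv:2503.14699). **Def. 3.10**: "we define the pair of vector
fields `v⁽¹⁾ = ∑_{k ≥ 0 even} v_k + ∑_{k ≥ 0 odd} v̄_k` and `v⁽²⁾ = ∑_{k ≥ 0 odd} v_k + ∑_{k ≥ 0 even} v̄_k`."
**Prop. 3.13**: "`v⁽¹⁾` and `v⁽²⁾` are smooth, divergence-free and mean-zero for `t > 0`, and obey
(3.13a) `‖∇ᵐ v⁽ⁱ⁾(t)‖_{L^∞} ≲_m t^{-(1+m)/2}` and (3.13b)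
`‖v⁽ⁱ⁾‖²_{L²_t L^∞_x([t₁,t₂])} + ‖t^{-1/2} v⁽ⁱ⁾‖_{L¹_t L^∞_x([t₁,t₂])} ≲ 1 + log(t₂/t₁)/log(N_{k+1}/N_k)`."

Grouping by frequency: `v̄_{k-1}` (`CP25.IterData.vCascade (k-1)`, time factors `e^{-2·rate_{k,j}t}`) and
`v_k` (`CP25.IterData.vHeat k`) both live at the scale `N_k`, so we set
`block k t = vHeat k t + vCascade (k-1) t` (`vCascade (-1) := 0`), and for a schedule `s : ℕ → ℕ`
`vSched s t x = ∑' i, block (s i) t x`; then `v⁽¹⁾ = vSched (2·)` (`= v₀ + (v₂ + v̄₁) + (v₄ + v̄₃) + ⋯`)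
and `v⁽²⁾ = vSched (2·+1)` (`= (v₁ + v̄₀) + (v₃ + v̄₂) + ⋯`). Everything below is proved for an
arbitrary strictly increasing schedule. Main results (`h : I.Admissible`, `hs : StrictMono s`, `t > 0`):

* `CP25.IterConsts.Bblk m = 6 (Cᵥ_m + C̄w_m) (2κ_{m+2})ᵐ` and the block bound
  `CP25.IterData.Admissible.norm_iteratedFDeriv_lift_block_le`:
  `‖Dᵐ(block k t)‖ ≤ Bblk_m · N_k^{m+1} e^{-4π²N_k²t}` ((vkbounds) + (vkbarbounds));
* `CP25.IterData.Admissible.deriv_le_vSched` — **(3.13a) in the tree's shape**: `vSched s t` is smooth and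
  `eSupNorm (iteratedFDeriv ℝ m (lift (vSched s t))) ≤ ofReal (Kderiv m * t^{-(m+1)/2})` for every `m`,
  with `CP25.IterConsts.Kderiv` a function of the level-independent constants ONLY (not of the scales);
* `CP25.IterData.Admissible.lacunary_le_vSched` — **(3.13b) in the tree's shape**:
  `∫_{t₁}^{t₂} (‖v(τ)‖²_∞ + τ^{-1/2}‖v(τ)‖_∞) dτ ≤ Clac · (1 + (log ρ)⁻¹ log(t₂/t₁))`, `CP25.IterConsts.Clac`
  again a function of the constants only and `ρ` the lacunarity ratio of the scales;
* `hasZeroMean_vSched`, `isDivFree_vSched` (termwise, by dominated summation / `fderiv_tsum_apply`),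
  `norm_vSched_le` (`‖v(t,x)‖ ≤ Bblk₀ ∑' N e^{-4π²N²t}`), `summable_block_apply`.

## Mathlib / tree search

Tree: `exists_eSupNorm_iteratedFDeriv_lift_tsum_le_of_lacunary` (`LacunarySmoothSeries`, (3.13a) for
abstract blocks), `exists_integral_tsum_sq_le_of_lacunary`, `integral_rpow_neg_half_mul_tsum_le_of_lacunary`,
`summable_rpow_mul_exp_neg_of_lacunary`, `continuousOn_tsum_mul_exp_neg_of_lacunary` (`LacunaryScaleSums`,
(3.13b) for abstract scale series), `hasLiftDerivBounds_vHeat`, `hasLiftDerivBounds_vCascade` and the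
div-free / mean-zero facts of the blocks (`MikadoHeatBlocks`, `MikadoCascadeBlocks`),
`Torus.isDivFree_iff_trace_fderiv_lift` (`TorusCalculus`). Mathlib: `fderiv_tsum_apply`,
`integral_tsum_of_summable_integral_norm`, `ContinuousLinearMap.map_tsum`, `integral_mono_of_nonneg`.

## On the hypothesis `h : I.Admissible`

`CP25.IterData.Admissible I` (a `structure … : Prop` of `MikadoDataIteration`) bundles the standing
HYPOTHESES on the abstract inputs `I` (profile bounds, unit phases, positive averages, scale relations,
cut-off bounds); the theorems below take `h : I.Admissible` as a section hypothesis (`variable … include h`).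
It is not a named fact and nothing here assumes a conclusion: the predicate is PROVED for the paper's
concrete inputs in `CP25.admissible_mkIter` (`MikadoInputs`), which is how these theorems are used.

## References

* M. P. Coiculescu, S. Palasek, Invent. Math. 244 (2025) 165–219, doi:10.1007/s00222-025-01396-z,
  arXiv:2503.14699: Def. 3.10, Prop. 3.13 ((3.13a) = (vweightedlinftybound), (3.13b) =
  (vl2intimelinftyinspacebound)) and its proof. [CoiculescuPalasek2025]
-/

noncomputable section

open MeasureTheory Set Filter Function
open _root_.Topology
open scoped BigOperators ContDiff ENNReal Interval

namespace Literature.Analysis.FluidPDE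

namespace CP25

open Literature.Analysis.FunctionSpaces Literature.Analysis.FunctionSpaces.Torus

/-! ## Absolute constants -/

/-- `0 < 4π²`. [folklore] -/
theorem four_pi_sq_pos : (0 : ℝ) < 4 * Real.pi ^ 2 := by positivity

/-- The first (3.13b) `L²` constant of `exists_integral_tsum_sq_le_of_lacunary` at `c = 4π²`. [folklore] -/
def lacSqC₁ : ℝ := Classical.choose (exists_integral_tsum_sq_le_of_lacunary four_pi_sq_pos)

/-- The second (3.13b) `L²` constant of `exists_integral_tsum_sq_le_of_lacunary` at `c = 4π²`. [folklore] -/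
def lacSqC₂ : ℝ := Classical.choose (Classical.choose_spec (exists_integral_tsum_sq_le_of_lacunary four_pi_sq_pos))

/-- The defining property of `lacSqC₁`, `lacSqC₂`. [cite: CoiculescuPalasek2025, Prop. 3.13 (vl2intimelinftyinspacebound)] -/
theorem lacSqC_spec : 0 ≤ lacSqC₁ ∧ 0 ≤ lacSqC₂ ∧ ∀ (N : ℕ → ℝ) (ρ : ℝ), (∀ k, 0 < N k) → 2 ≤ ρ →
    (∀ k, ρ * N k ≤ N (k + 1)) → ∀ t₁ t₂ : ℝ, 0 < t₁ → t₁ ≤ t₂ →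
      ∫ t in t₁..t₂, (∑' k, N k * Real.exp (-(4 * Real.pi ^ 2 * N k ^ 2 * t))) ^ 2 ≤
        lacSqC₁ + lacSqC₂ * (Real.log (t₂ / t₁) / Real.log ρ) :=
  Classical.choose_spec (Classical.choose_spec (exists_integral_tsum_sq_le_of_lacunary four_pi_sq_pos))

/-! ## The block constants (functions of the level-independent constants only) -/

namespace IterConsts

variable (C : IterConsts)

/-- The block constant `Bblk_m = 6 (Cᵥ_m + C̄w_m) (2κ_{m+2})ᵐ`: `‖Dᵐ(v_k + v̄_{k-1})(t)‖ ≤ Bblk_m N_k^{m+1} e^{-4π²N_k²t}`.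
[cite: CoiculescuPalasek2025, Prop. 3.13 (vkbounds), (vkbarbounds)] -/
def Bblk (m : ℕ) : ℝ := 6 * (C.Cv m + C.Cw m) * (2 * C.κ (m + 2)) ^ m

/-- **The (3.13a) constants `K_m`**, chosen once and for all from the block constants (choice from
`exists_eSupNorm_iteratedFDeriv_lift_tsum_le_of_lacunary` with `c = 4π²`); independent of the scales.
[cite: CoiculescuPalasek2025, Prop. 3.13 (vweightedlinftybound)] -/
def Kderiv : ℕ → ℝ :=
  Classical.choose (exists_eSupNorm_iteratedFDeriv_lift_tsum_le_of_lacunary (d := Fin 3)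
    (G := EuclideanSpace ℝ (Fin 3)) four_pi_sq_pos C.Bblk)

/-- The defining property of `Kderiv`. [cite: CoiculescuPalasek2025, Prop. 3.13 (vweightedlinftybound)] -/
theorem Kderiv_spec : ∀ (N : ℕ → ℝ), (∀ i, 0 < N i) → (∀ i, 2 * N i ≤ N (i + 1)) →
    ∀ t : ℝ, 0 < t → ∀ (v : ℕ → UnitAddTorus (Fin 3) → EuclideanSpace ℝ (Fin 3)), (∀ i, IsSmooth (v i)) →
      (∀ (m i : ℕ) (y : EuclideanSpace ℝ (Fin 3)), ‖iteratedFDeriv ℝ m (Torus.lift (v i)) y‖ ≤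
        C.Bblk m * (N i ^ ((m : ℝ) + 1) * Real.exp (-(4 * Real.pi ^ 2 * N i ^ 2 * t)))) →
      IsSmooth (fun x => ∑' i, v i x) ∧
        ∀ m : ℕ, eSupNorm (iteratedFDeriv ℝ m (Torus.lift (fun x => ∑' i, v i x))) ≤
          ENNReal.ofReal (C.Kderiv m * t ^ (-(((m : ℝ) + 1) / 2))) :=
  Classical.choose_spec (exists_eSupNorm_iteratedFDeriv_lift_tsum_le_of_lacunary (d := Fin 3)
    (G := EuclideanSpace ℝ (Fin 3)) four_pi_sq_pos C.Bblk)

/-- **The (3.13b) constant** `Clac = Bblk₀² (C₁ + C₂) + Bblk₀ ((6 + 1/c + 1/c²) + (1 + 1/(2c)))`, `c = 4π²`.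
[cite: CoiculescuPalasek2025, Prop. 3.13 (vl2intimelinftyinspacebound)] -/
def Clac : ℝ :=
  C.Bblk 0 ^ 2 * (lacSqC₁ + lacSqC₂) +
    C.Bblk 0 * ((6 + 1 / (4 * Real.pi ^ 2) + 1 / (4 * Real.pi ^ 2) ^ 2) + (1 + 1 / (2 * (4 * Real.pi ^ 2))))

end IterConsts

/-! ## The blocks `v_k + v̄_{k-1}` and the scheduled sums -/

namespace IterData

variable (I : IterData)

/-- `v̄_{k-1}` with the convention `v̄_{-1} = 0`. [cite: CoiculescuPalasek2025, Def. 3.10] -/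
def cascadePrev : ℕ → ℝ → UnitAddTorus (Fin 3) → EuclideanSpace ℝ (Fin 3)
  | 0 => fun _ _ => 0
  | k + 1 => I.vCascade k

/-- **The scale-`N_k` block `v_k(t) + v̄_{k-1}(t)`** of the principal parts. [cite: CoiculescuPalasek2025, Def. 3.10] -/
def block (k : ℕ) (t : ℝ) (x : UnitAddTorus (Fin 3)) : EuclideanSpace ℝ (Fin 3) :=
  I.vHeat k t x + I.cascadePrev k t x

/-- **The scheduled principal part** `∑' i, block (s i) t`; `s = (2·)` gives `v⁽¹⁾`, `s = (2·+1)` gives `v⁽²⁾`.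
[cite: CoiculescuPalasek2025, Def. 3.10] -/
def vSched (s : ℕ → ℕ) (t : ℝ) (x : UnitAddTorus (Fin 3)) : EuclideanSpace ℝ (Fin 3) :=
  ∑' i, I.block (s i) t x

/-- **`v⁽¹⁾ = ∑_{k even} v_k + ∑_{k odd} v̄_k`**. [cite: CoiculescuPalasek2025, Def. 3.10] -/
def vOne : ℝ → UnitAddTorus (Fin 3) → EuclideanSpace ℝ (Fin 3) := I.vSched fun i => 2 * i

/-- **`v⁽²⁾ = ∑_{k odd} v_k + ∑_{k even} v̄_k`**. [cite: CoiculescuPalasek2025, Def. 3.10] -/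
def vTwo : ℝ → UnitAddTorus (Fin 3) → EuclideanSpace ℝ (Fin 3) := I.vSched fun i => 2 * i + 1

/-- The scale series `S_s(t) = ∑' i, N_{s i} e^{-4π² N_{s i}² t}` dominating `‖vSched s t‖_∞ / Bblk₀`.
[cite: CoiculescuPalasek2025, Prop. 3.13 (proof)] -/
def scaleSeries (s : ℕ → ℕ) (t : ℝ) : ℝ :=
  ∑' i, (I.N (s i) : ℝ) * Real.exp (-(4 * Real.pi ^ 2 * (I.N (s i) : ℝ) ^ 2 * t))

/-- `v⁽¹⁾` is the even schedule. [folklore] -/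
theorem vOne_eq : I.vOne = I.vSched fun i => 2 * i := rfl

/-- `v⁽²⁾` is the odd schedule. [folklore] -/
theorem vTwo_eq : I.vTwo = I.vSched fun i => 2 * i + 1 := rfl

/-- The even schedule is strictly increasing. [folklore] -/
theorem strictMono_two_mul : StrictMono fun i : ℕ => 2 * i := fun a b hab => by
  show 2 * a < 2 * b; omega

/-- The odd schedule is strictly increasing. [folklore] -/
theorem strictMono_two_mul_add_one : StrictMono fun i : ℕ => 2 * i + 1 := fun a b hab => by
  show 2 * a + 1 < 2 * b + 1; omega

namespace Admissible

variable {I} (h : I.Admissible)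
include h

/-! ### Scales along a schedule -/

/-- The scales are monotone. [folklore] -/
theorem N_mono : Monotone fun k => (I.N k : ℝ) := monotone_nat_of_le_succ h.N_le_succ

/-- `2 N_k ≤ N_l` for `k < l`. [folklore] -/
theorem two_mul_N_le_of_lt {k l : ℕ} (hkl : k < l) : 2 * (I.N k : ℝ) ≤ I.N l :=
  (h.two_mul_N_le k).trans (h.N_mono (Nat.succ_le_of_lt hkl))

/-- `ρ N_k ≤ N_l` for `k < l`. [folklore] -/
theorem ρ_mul_N_le_of_lt {k l : ℕ} (hkl : k < l) : I.ρ * (I.N k : ℝ) ≤ I.N l :=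
  (h.ρ_lacunary k).trans (h.N_mono (Nat.succ_le_of_lt hkl))

omit h in
/-- A strictly increasing schedule increases at each step. [folklore] -/
theorem sched_lt {s : ℕ → ℕ} (hs : StrictMono s) (i : ℕ) : s i < s (i + 1) := hs (Nat.lt_succ_self i)

/-- Positivity of the scheduled scales. [folklore] -/
theorem schedN_pos (s : ℕ → ℕ) (i : ℕ) : (0 : ℝ) < I.N (s i) := h.N_pos' _

/-- Lacunarity (ratio `2`) of the scheduled scales. [folklore] -/
theorem two_mul_schedN_le {s : ℕ → ℕ} (hs : StrictMono s) (i : ℕ) :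
    2 * (I.N (s i) : ℝ) ≤ I.N (s (i + 1)) := h.two_mul_N_le_of_lt (sched_lt hs i)

/-- Lacunarity (ratio `ρ`) of the scheduled scales. [folklore] -/
theorem ρ_mul_schedN_le {s : ℕ → ℕ} (hs : StrictMono s) (i : ℕ) :
    I.ρ * (I.N (s i) : ℝ) ≤ I.N (s (i + 1)) := h.ρ_mul_N_le_of_lt (sched_lt hs i)

/-! ### Nonnegativity of the constants -/

/-- `0 ≤ Cᵥ_n`. [folklore] -/
theorem Cv_nonneg (n : ℕ) : 0 ≤ I.cst.Cv n := by
  have h1 := I.cst.one_le_Camp (n + 2); have h2 := h.G_nonneg (n + 2); have h3 := (h.κ_pos (n + 2)).le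
  unfold IterConsts.Cv; positivity

/-- `0 ≤ C̄w_n`. [folklore] -/
theorem Cw_nonneg (n : ℕ) : 0 ≤ I.cst.Cw n := by
  have h1 := I.cst.one_le_Camp (n + 2); have h2 := h.cχ_nonneg (n + 2)
  have h3 := one_le_derivProfileMassSup (d := Fin 3) (n + 2)
  have h4 := one_le_czConstSup (α := 1 / 2) (by norm_num) (by norm_num) n
  unfold IterConsts.Cw; positivity

/-- `0 ≤ Bblk_m`. [folklore] -/
theorem Bblk_nonneg (m : ℕ) : 0 ≤ I.cst.Bblk m := by
  have h1 := h.Cv_nonneg m; have h2 := h.Cw_nonneg m; have h3 := (h.κ_pos (m + 2)).le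
  unfold IterConsts.Bblk; positivity

omit h in
/-- `Bblk₀ = 6 (Cᵥ₀ + C̄w₀)`. [folklore] -/
theorem Bblk_zero : I.cst.Bblk 0 = 6 * (I.cst.Cv 0 + I.cst.Cw 0) := by
  simp [IterConsts.Bblk]

/-- `0 ≤ Clac`. [folklore] -/
theorem Clac_nonneg : 0 ≤ I.cst.Clac := by
  have h1 := h.Bblk_nonneg 0; have h2 := lacSqC_spec.1; have h3 := lacSqC_spec.2.1
  have h4 : (0 : ℝ) < 4 * Real.pi ^ 2 := four_pi_sq_pos
  unfold IterConsts.Clac; positivity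

/-! ### The blocks: bounds, smoothness, mean zero, divergence free -/

/-- The cascade piece in the currency: `HasLiftDerivBounds m (v̄_{k-1}(t)) (6 C̄w_m N_k e^{-4π²N_k²t}) (2κ_{m+2}N_k)`,
`t ≥ 0` (from `hasLiftDerivBounds_vCascade`, `4c_{m+2} ≤ 2κ_{m+2}`). [cite: CoiculescuPalasek2025, Prop. 3.13 (vkbarbounds)] -/
theorem hasLiftDerivBounds_cascadePrev (m k : ℕ) {t : ℝ} (ht : 0 ≤ t) :
    HasLiftDerivBounds m (I.cascadePrev k t)
      (6 * (I.cst.Cw m * I.N k * Real.exp (-(4 * Real.pi ^ 2 * (I.N k : ℝ) ^ 2 * t))))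
      (2 * I.cst.κ (m + 2) * I.N k) := by
  have hκ := (h.κ_pos (m + 2)).le
  cases k with
  | zero =>
    have hL : 0 ≤ 2 * I.cst.κ (m + 2) * I.N 0 := by have := (h.N_pos' 0).le; positivity
    have hC : (0 : ℝ) ≤ 6 * (I.cst.Cw m * I.N 0 * Real.exp (-(4 * Real.pi ^ 2 * (I.N 0 : ℝ) ^ 2 * t))) := by
      have := h.Cw_nonneg m; have := (h.N_pos' 0).le; positivity
    exact (hasLiftDerivBounds_zero (d := Fin 3) (F := EuclideanSpace ℝ (Fin 3)) m hL).mono hC hL le_rfl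
  | succ k =>
    have hv := h.hasLiftDerivBounds_vCascade m k ht
    have hL0 : 0 ≤ 4 * (derivProfileMassSup (Fin 3) (m + 2) + I.cst.cχ (m + 2)) * I.N (k + 1) := by
      have := one_le_derivProfileMassSup (d := Fin 3) (m + 2); have := h.cχ_nonneg (m + 2)
      have := (h.N_pos' (k + 1)).le; positivity
    refine hv.mono le_rfl hL0 ?_
    have hN := (h.N_pos' (k + 1)).le
    have hle : 4 * (derivProfileMassSup (Fin 3) (m + 2) + I.cst.cχ (m + 2)) ≤ 2 * I.cst.κ (m + 2) := by
      unfold IterConsts.κ; linarith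
    exact mul_le_mul_of_nonneg_right hle hN

/-- **The block in the currency**: `HasLiftDerivBounds m (v_k(t) + v̄_{k-1}(t)) (6 (Cᵥ_m + C̄w_m) N_k e^{-4π²N_k²t}) (2κ_{m+2}N_k)`
for `t ≥ 0`. [cite: CoiculescuPalasek2025, Prop. 3.13 (vkbounds), (vkbarbounds)] -/
theorem hasLiftDerivBounds_block (m k : ℕ) {t : ℝ} (ht : 0 ≤ t) :
    HasLiftDerivBounds m (I.block k t)
      (6 * ((I.cst.Cv m + I.cst.Cw m) * I.N k * Real.exp (-(4 * Real.pi ^ 2 * (I.N k : ℝ) ^ 2 * t))))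
      (2 * I.cst.κ (m + 2) * I.N k) := by
  have hκ := (h.κ_pos (m + 2)).le
  have hN := (h.N_pos' k).le
  have hL1 : 0 ≤ I.cst.κ (m + 2) * I.N k := by positivity
  have h1 := (h.hasLiftDerivBounds_vHeat m k ht).mono le_rfl hL1
    (show I.cst.κ (m + 2) * I.N k ≤ 2 * I.cst.κ (m + 2) * I.N k by nlinarith)
  have h2 := h.hasLiftDerivBounds_cascadePrev m k ht
  have h12 := h1.add h2
  refine h12.mono (le_of_eq (by ring)) (by positivity) le_rfl

/-- **The block bound in the lacunary-series shape**: `‖Dᵐ(lift (v_k + v̄_{k-1})(t)) y‖ ≤ Bblk_m · N_k^{m+1} e^{-4π²N_k²t}`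
(`t ≥ 0`, all `m`, `k`, `y`). [cite: CoiculescuPalasek2025, Prop. 3.13 (vkbounds), (vkbarbounds)] -/
theorem norm_iteratedFDeriv_lift_block_le (m k : ℕ) {t : ℝ} (ht : 0 ≤ t) (y : EuclideanSpace ℝ (Fin 3)) :
    ‖iteratedFDeriv ℝ m (Torus.lift (I.block k t)) y‖ ≤
      I.cst.Bblk m * ((I.N k : ℝ) ^ ((m : ℝ) + 1) * Real.exp (-(4 * Real.pi ^ 2 * (I.N k : ℝ) ^ 2 * t))) := by
  have hb := (h.hasLiftDerivBounds_block m k ht).bound le_rfl y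
  refine hb.trans (le_of_eq ?_)
  have hr : (I.N k : ℝ) ^ ((m : ℝ) + 1) = (I.N k : ℝ) ^ (m + 1) := by
    rw [show ((m : ℝ) + 1) = ((m + 1 : ℕ) : ℝ) by push_cast; ring, Real.rpow_natCast]
  rw [hr, IterConsts.Bblk]; ring

/-- The block bound at order `0`: `‖(v_k + v̄_{k-1})(t, x)‖ ≤ Bblk₀ N_k e^{-4π²N_k²t}`. [cite: CoiculescuPalasek2025, Prop. 3.13] -/
theorem norm_block_le (k : ℕ) {t : ℝ} (ht : 0 ≤ t) (x : UnitAddTorus (Fin 3)) :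
    ‖I.block k t x‖ ≤ I.cst.Bblk 0 * ((I.N k : ℝ) * Real.exp (-(4 * Real.pi ^ 2 * (I.N k : ℝ) ^ 2 * t))) := by
  have hb := (h.hasLiftDerivBounds_block 0 k ht).norm_le x
  rw [Bblk_zero]; linarith

/-- The blocks are smooth (all `t`). [folklore] -/
theorem isSmooth_cascadePrev (k : ℕ) (t : ℝ) : IsSmooth (I.cascadePrev k t) := by
  cases k with
  | zero => exact isSmooth_const _
  | succ k => exact h.isSmooth_vCascade k t

/-- The blocks are smooth (all `t`). [folklore] -/
theorem isSmooth_block (k : ℕ) (t : ℝ) : IsSmooth (I.block k t) :=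
  (h.isSmooth_vHeat k t).add (h.isSmooth_cascadePrev k t)

/-- `v̄_{k-1}(t)` has zero mean. [cite: CoiculescuPalasek2025, Prop. 3.13] -/
theorem hasZeroMean_cascadePrev (k : ℕ) (t : ℝ) : Torus.HasZeroMean (I.cascadePrev k t) := by
  cases k with
  | zero => simp [cascadePrev, Torus.HasZeroMean]
  | succ k => exact h.hasZeroMean_vCascade k t

/-- **The blocks have zero mean.** [cite: CoiculescuPalasek2025, Prop. 3.13] -/
theorem hasZeroMean_block (k : ℕ) (t : ℝ) : Torus.HasZeroMean (I.block k t) := by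
  have h1 := h.hasZeroMean_vHeat k t
  have h2 := h.hasZeroMean_cascadePrev k t
  unfold Torus.HasZeroMean at h1 h2 ⊢
  have hi1 : Integrable (I.vHeat k t) volume := (h.isSmooth_vHeat k t).continuous.integrable_unitAddTorus
  have hi2 : Integrable (I.cascadePrev k t) volume := (h.isSmooth_cascadePrev k t).continuous.integrable_unitAddTorus
  change ∫ x, (I.vHeat k t x + I.cascadePrev k t x) = 0
  rw [integral_add hi1 hi2, h1, h2, add_zero]

omit h in
/-- The sum of two smooth divergence-free fields is divergence free. [folklore] -/
theorem isDivFree_add' {u v : UnitAddTorus (Fin 3) → EuclideanSpace ℝ (Fin 3)} (hu : IsSmooth u) (hv : IsSmooth v)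
    (hu0 : Torus.IsDivFree u) (hv0 : Torus.IsDivFree v) : Torus.IsDivFree fun x => u x + v x := by
  have hu1 : IsContDiff 1 u := hu.isContDiff (by simp)
  have hv1 : IsContDiff 1 v := hv.isContDiff (by simp)
  have huv1 : IsContDiff 1 (fun x => u x + v x) := (hu.add hv).isContDiff (by simp)
  rw [isDivFree_iff_trace_fderiv_lift huv1]
  rw [isDivFree_iff_trace_fderiv_lift hu1] at hu0
  rw [isDivFree_iff_trace_fderiv_lift hv1] at hv0
  intro y
  have hl : Torus.lift (fun x => u x + v x) = Torus.lift u + Torus.lift v := rfl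
  have hdu : DifferentiableAt ℝ (Torus.lift u) y := ((hu1.differentiable (by simp)) y)
  have hdv : DifferentiableAt ℝ (Torus.lift v) y := ((hv1.differentiable (by simp)) y)
  rw [hl, fderiv_add hdu hdv]
  push_cast
  rw [map_add, hu0 y, hv0 y, add_zero]

/-- `v̄_{k-1}(t)` is divergence free. [cite: CoiculescuPalasek2025, Prop. 3.13] -/
theorem isDivFree_cascadePrev (k : ℕ) (t : ℝ) : Torus.IsDivFree (I.cascadePrev k t) := by
  cases k with
  | zero =>
    intro x
    change Torus.divergence (fun _ : UnitAddTorus (Fin 3) => (0 : EuclideanSpace ℝ (Fin 3))) x = 0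
    simp [Torus.divergence, Torus.partialDeriv, Torus.lineDeriv]
  | succ k => exact h.isDivFree_vCascade k t

/-- **The blocks are divergence free.** [cite: CoiculescuPalasek2025, Prop. 3.13] -/
theorem isDivFree_block (k : ℕ) (t : ℝ) : Torus.IsDivFree (I.block k t) :=
  isDivFree_add' (h.isSmooth_vHeat k t) (h.isSmooth_cascadePrev k t) (h.isDivFree_vHeat k t)
    (h.isDivFree_cascadePrev k t)

/-! ### The scheduled sums at a fixed time `t > 0` -/

section Sched

variable {s : ℕ → ℕ}

/-- Summability of the scale series with any exponent. [folklore] -/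
theorem summable_schedN_rpow (hs : StrictMono s) {a : ℝ} (ha : 0 < a) {t : ℝ} (ht : 0 < t) :
    Summable fun i => (I.N (s i) : ℝ) ^ a * Real.exp (-(4 * Real.pi ^ 2 * (I.N (s i) : ℝ) ^ 2 * t)) :=
  summable_rpow_mul_exp_neg_of_lacunary (N := fun i => (I.N (s i) : ℝ)) (h.schedN_pos s)
    (h.two_mul_schedN_le hs) ha four_pi_sq_pos ht

/-- Summability of the scale series. [folklore] -/
theorem summable_schedN (hs : StrictMono s) {t : ℝ} (ht : 0 < t) :
    Summable fun i => (I.N (s i) : ℝ) * Real.exp (-(4 * Real.pi ^ 2 * (I.N (s i) : ℝ) ^ 2 * t)) := by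
  have h1 := h.summable_schedN_rpow hs one_pos ht
  simp_rw [Real.rpow_one] at h1
  exact h1

/-- `0 ≤ S_s(t)`. [folklore] -/
theorem scaleSeries_nonneg (s : ℕ → ℕ) (t : ℝ) : 0 ≤ I.scaleSeries s t :=
  tsum_nonneg fun i => by have := h.N_pos' (s i); positivity

/-- **Pointwise summability of the scheduled series** for `t > 0`. [cite: CoiculescuPalasek2025, Prop. 3.13] -/
theorem summable_block_apply (hs : StrictMono s) {t : ℝ} (ht : 0 < t) (x : UnitAddTorus (Fin 3)) :
    Summable fun i => I.block (s i) t x :=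
  Summable.of_norm_bounded ((h.summable_schedN hs ht).mul_left (I.cst.Bblk 0))
    (fun i => h.norm_block_le (s i) ht.le x)

/-- Summability of the lifted derivative series (order `m`), for `t > 0`. [folklore] -/
theorem summable_iteratedFDeriv_lift_block (hs : StrictMono s) {t : ℝ} (ht : 0 < t) (m : ℕ)
    (y : EuclideanSpace ℝ (Fin 3)) :
    Summable fun i => iteratedFDeriv ℝ m (Torus.lift (I.block (s i) t)) y :=
  Summable.of_norm_bounded ((h.summable_schedN_rpow hs (by positivity : (0:ℝ) < (m : ℝ) + 1) ht).mul_left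
    (I.cst.Bblk m)) (fun i => h.norm_iteratedFDeriv_lift_block_le m (s i) ht.le y)

/-- **The pointwise bound `‖v(t, x)‖ ≤ Bblk₀ S_s(t)`** for `t > 0`. [cite: CoiculescuPalasek2025, Prop. 3.13 (proof)] -/
theorem norm_vSched_le (hs : StrictMono s) {t : ℝ} (ht : 0 < t) (x : UnitAddTorus (Fin 3)) :
    ‖I.vSched s t x‖ ≤ I.cst.Bblk 0 * I.scaleSeries s t := by
  unfold vSched scaleSeries
  rw [← tsum_mul_left]
  exact tsum_of_norm_bounded ((h.summable_schedN hs ht).mul_left (I.cst.Bblk 0)).hasSum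
    fun i => h.norm_block_le (s i) ht.le x

/-- `eSupNorm (v(t)) ≤ ofReal (Bblk₀ S_s(t))` for `t > 0`. [cite: CoiculescuPalasek2025, Prop. 3.13 (proof)] -/
theorem eSupNorm_vSched_le (hs : StrictMono s) {t : ℝ} (ht : 0 < t) :
    eSupNorm (I.vSched s t) ≤ ENNReal.ofReal (I.cst.Bblk 0 * I.scaleSeries s t) :=
  eSupNorm_le_ofReal fun x => h.norm_vSched_le hs ht x

/-- `(eSupNorm (v(t))).toReal ≤ Bblk₀ S_s(t)` for `t > 0`. [folklore] -/
theorem toReal_eSupNorm_vSched_le (hs : StrictMono s) {t : ℝ} (ht : 0 < t) :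
    (eSupNorm (I.vSched s t)).toReal ≤ I.cst.Bblk 0 * I.scaleSeries s t :=
  ENNReal.toReal_le_of_le_ofReal (mul_nonneg (h.Bblk_nonneg 0) (h.scaleSeries_nonneg s t))
    (h.eSupNorm_vSched_le hs ht)

/-- **(3.13a) in the tree's shape** (`IsApproximateSolution.deriv_le`): for `t > 0` the scheduled sum is smooth
and `eSupNorm (iteratedFDeriv ℝ m (lift (v(t)))) ≤ ofReal (Kderiv m · t^{-(m+1)/2})` for every `m`, with
`Kderiv` depending only on the level-independent constants. [cite: CoiculescuPalasek2025, Prop. 3.13 (vweightedlinftybound)] -/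
theorem deriv_le_vSched (hs : StrictMono s) {t : ℝ} (ht : 0 < t) :
    IsSmooth (I.vSched s t) ∧
      ∀ m : ℕ, eSupNorm (iteratedFDeriv ℝ m (Torus.lift (I.vSched s t))) ≤
        ENNReal.ofReal (I.cst.Kderiv m * t ^ (-(((m : ℝ) + 1) / 2))) :=
  I.cst.Kderiv_spec (fun i => (I.N (s i) : ℝ)) (h.schedN_pos s) (h.two_mul_schedN_le hs) t ht
    (fun i => I.block (s i) t) (fun i => h.isSmooth_block (s i) t)
    (fun m i y => h.norm_iteratedFDeriv_lift_block_le m (s i) ht.le y)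

/-- **(3.13a), literally the clause `IsApproximateSolution.deriv_le`** (exponent written `-(m+1)/2`).
[cite: CoiculescuPalasek2025, Prop. 3.13 (vweightedlinftybound)] -/
theorem eSupNorm_iteratedFDeriv_lift_vSched_le (hs : StrictMono s) (m : ℕ) {t : ℝ} (ht : 0 < t) :
    eSupNorm (iteratedFDeriv ℝ m (Torus.lift (I.vSched s t))) ≤
      ENNReal.ofReal (I.cst.Kderiv m * t ^ (-((m : ℝ) + 1) / 2)) := by
  rw [neg_div]; exact (h.deriv_le_vSched hs ht).2 m

/-- The scheduled sum is smooth for `t > 0`. [cite: CoiculescuPalasek2025, Prop. 3.13] -/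
theorem isSmooth_vSched (hs : StrictMono s) {t : ℝ} (ht : 0 < t) : IsSmooth (I.vSched s t) :=
  (h.deriv_le_vSched hs ht).1

/-- **The scheduled sum has zero mean** for `t > 0` (termwise integration). [cite: CoiculescuPalasek2025, Prop. 3.13] -/
theorem hasZeroMean_vSched (hs : StrictMono s) {t : ℝ} (ht : 0 < t) : Torus.HasZeroMean (I.vSched s t) := by
  unfold Torus.HasZeroMean vSched
  have hint : ∀ i, Integrable (I.block (s i) t) volume := fun i =>
    (h.isSmooth_block (s i) t).continuous.integrable_unitAddTorus
  have hle : ∀ i, ∫ x, ‖I.block (s i) t x‖ ≤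
      I.cst.Bblk 0 * ((I.N (s i) : ℝ) * Real.exp (-(4 * Real.pi ^ 2 * (I.N (s i) : ℝ) ^ 2 * t))) := by
    intro i
    calc ∫ x, ‖I.block (s i) t x‖
        ≤ ∫ _x : UnitAddTorus (Fin 3), I.cst.Bblk 0 * ((I.N (s i) : ℝ) * Real.exp (-(4 * Real.pi ^ 2 * (I.N (s i) : ℝ) ^ 2 * t))) :=
          integral_mono (hint i).norm (integrable_const _) fun x => h.norm_block_le (s i) ht.le x
      _ = _ := by simp
  have hsum : Summable fun i => ∫ x, ‖I.block (s i) t x‖ :=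
    Summable.of_nonneg_of_le (fun i => integral_nonneg fun x => norm_nonneg _) hle
      ((h.summable_schedN hs ht).mul_left _)
  rw [← integral_tsum_of_summable_integral_norm hint hsum]
  exact (tsum_congr fun i => h.hasZeroMean_block (s i) t).trans tsum_zero

/-- **The scheduled sum is divergence free** for `t > 0` (termwise differentiation of the lifted series,
`fderiv_tsum_apply`, and continuity of the trace). [cite: CoiculescuPalasek2025, Prop. 3.13] -/
theorem isDivFree_vSched (hs : StrictMono s) {t : ℝ} (ht : 0 < t) : Torus.IsDivFree (I.vSched s t) := by
  have hsm := h.isSmooth_vSched hs ht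
  rw [isDivFree_iff_trace_fderiv_lift (hsm.isContDiff (by simp))]
  intro y
  -- the lifted series and its termwise derivative
  set f : ℕ → EuclideanSpace ℝ (Fin 3) → EuclideanSpace ℝ (Fin 3) := fun i => Torus.lift (I.block (s i) t) with hf
  have hlift : Torus.lift (I.vSched s t) = fun y => ∑' i, f i y := rfl
  have hdiff : ∀ i, Differentiable ℝ (f i) := fun i =>
    ((h.isSmooth_block (s i) t).isContDiff (n := 1) (by simp)).differentiable (by simp)
  -- bound on the derivatives: `‖fderiv (f i) y‖ = ‖D¹ f i y‖ ≤ Bblk₁ N² e^{-cN²t}`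
  set u : ℕ → ℝ := fun i => I.cst.Bblk 1 * ((I.N (s i) : ℝ) ^ (((1 : ℕ) : ℝ) + 1) *
    Real.exp (-(4 * Real.pi ^ 2 * (I.N (s i) : ℝ) ^ 2 * t))) with hu
  have hu_sum : Summable u :=
    (h.summable_schedN_rpow hs (by positivity : (0:ℝ) < ((1 : ℕ) : ℝ) + 1) ht).mul_left _
  have hbound : ∀ i y, ‖fderiv ℝ (f i) y‖ ≤ u i := by
    intro i y
    rw [← norm_iteratedFDeriv_zero (𝕜 := ℝ) (f := fderiv ℝ (f i)) (x := y), norm_iteratedFDeriv_fderiv]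
    exact h.norm_iteratedFDeriv_lift_block_le 1 (s i) ht.le y
  have hf0 : Summable fun i => f i y := h.summable_block_apply hs ht (Torus.proj y)
  have hderiv : fderiv ℝ (fun y => ∑' i, f i y) y = ∑' i, fderiv ℝ (f i) y :=
    fderiv_tsum_apply hu_sum hdiff hbound hf0 y
  have hsumd : Summable fun i => fderiv ℝ (f i) y := Summable.of_norm_bounded hu_sum fun i => hbound i y
  -- the trace as a continuous linear functional on `E →L E`
  set T : (EuclideanSpace ℝ (Fin 3) →L[ℝ] EuclideanSpace ℝ (Fin 3)) →L[ℝ] ℝ :=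
    LinearMap.toContinuousLinearMap
      ((LinearMap.trace ℝ (EuclideanSpace ℝ (Fin 3))).comp (ContinuousLinearMap.coeLM ℝ)) with hT
  have hTapp : ∀ A : EuclideanSpace ℝ (Fin 3) →L[ℝ] EuclideanSpace ℝ (Fin 3),
      T A = LinearMap.trace ℝ (EuclideanSpace ℝ (Fin 3)) (A : EuclideanSpace ℝ (Fin 3) →ₗ[ℝ] EuclideanSpace ℝ (Fin 3)) :=
    fun A => rfl
  have hterm : ∀ i, T (fderiv ℝ (f i) y) = 0 := by
    intro i
    rw [hTapp]
    have hdf := h.isDivFree_block (s i) t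
    rw [isDivFree_iff_trace_fderiv_lift ((h.isSmooth_block (s i) t).isContDiff (by simp))] at hdf
    exact hdf y
  rw [← hTapp, hlift, hderiv, T.map_tsum hsumd]
  simp [hterm]

end Sched

/-! ### (3.13b): the lacunary `L²_t L^∞_x` and weighted `L¹_t L^∞_x` bound -/

section Lacunary

variable {s : ℕ → ℕ}

/-- `log ρ > 0`. [folklore] -/
theorem log_ρ_pos : 0 < Real.log I.ρ := Real.log_pos (by linarith [h.two_le_ρ])

/-- The scale series is continuous on `[t₁, t₂]`, `t₁ > 0`. [folklore] -/
theorem continuousOn_scaleSeries (hs : StrictMono s) {t₁ t₂ : ℝ} (ht₁ : 0 < t₁) :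
    ContinuousOn (I.scaleSeries s) (Icc t₁ t₂) :=
  continuousOn_tsum_mul_exp_neg_of_lacunary (N := fun i => (I.N (s i) : ℝ)) (h.schedN_pos s)
    (h.two_mul_schedN_le hs) four_pi_sq_pos ht₁

/-- `∫_{t₁}^{t₂} S² ≤ C₁ + C₂ log(t₂/t₁)/log ρ`. [cite: CoiculescuPalasek2025, Prop. 3.13 (vl2intimelinftyinspacebound)] -/
theorem integral_scaleSeries_sq_le (hs : StrictMono s) {t₁ t₂ : ℝ} (ht₁ : 0 < t₁) (h12 : t₁ ≤ t₂) :
    ∫ τ in t₁..t₂, I.scaleSeries s τ ^ 2 ≤ lacSqC₁ + lacSqC₂ * (Real.log (t₂ / t₁) / Real.log I.ρ) :=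
  lacSqC_spec.2.2 (fun i => (I.N (s i) : ℝ)) I.ρ (h.schedN_pos s) h.two_le_ρ (h.ρ_mul_schedN_le hs)
    t₁ t₂ ht₁ h12

/-- `∫_{t₁}^{t₂} τ^{-1/2} S ≤ 6 + 1/c + 1/c² + (1 + 1/(2c)) log(t₂/t₁)/log ρ`, `c = 4π²`.
[cite: CoiculescuPalasek2025, Prop. 3.13 (vl2intimelinftyinspacebound)] -/
theorem integral_rpow_mul_scaleSeries_le (hs : StrictMono s) {t₁ t₂ : ℝ} (ht₁ : 0 < t₁) (h12 : t₁ ≤ t₂) :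
    ∫ τ in t₁..t₂, τ ^ (-(1 / 2 : ℝ)) * I.scaleSeries s τ ≤
      6 + 1 / (4 * Real.pi ^ 2) + 1 / (4 * Real.pi ^ 2) ^ 2 +
        (1 + 1 / (2 * (4 * Real.pi ^ 2))) * (Real.log (t₂ / t₁) / Real.log I.ρ) :=
  integral_rpow_neg_half_mul_tsum_le_of_lacunary (N := fun i => (I.N (s i) : ℝ)) (h.schedN_pos s)
    h.two_le_ρ (h.ρ_mul_schedN_le hs) four_pi_sq_pos ht₁ h12

/-- **(3.13b) in the tree's shape** (`IsApproximateSolution.lacunary_le`, with slope `(log ρ)⁻¹`): for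
`0 < t₁ ≤ t₂`,
`∫_{t₁}^{t₂} ((eSupNorm v(τ)).toReal² + τ^{-1/2} (eSupNorm v(τ)).toReal) dτ ≤ Clac (1 + (log ρ)⁻¹ log(t₂/t₁))`,
`Clac` depending only on the level-independent constants. No measurability of `τ ↦ ‖v(τ)‖_∞` is needed:
the integrand is nonnegative and dominated by the continuous `Bblk₀² S² + Bblk₀ τ^{-1/2} S`
(`integral_mono_of_nonneg`). [cite: CoiculescuPalasek2025, Prop. 3.13 (vl2intimelinftyinspacebound)] -/
theorem lacunary_le_vSched (hs : StrictMono s) {t₁ t₂ : ℝ} (ht₁ : 0 < t₁) (h12 : t₁ ≤ t₂) :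
    ∫ τ in t₁..t₂, ((eSupNorm (I.vSched s τ)).toReal ^ 2 + τ ^ (-(1 / 2 : ℝ)) * (eSupNorm (I.vSched s τ)).toReal) ≤
      I.cst.Clac * (1 + (Real.log I.ρ)⁻¹ * Real.log (t₂ / t₁)) := by
  set B := I.cst.Bblk 0 with hB
  have hB0 : 0 ≤ B := h.Bblk_nonneg 0
  set S := I.scaleSeries s with hS
  set g : ℝ → ℝ := fun τ => B ^ 2 * S τ ^ 2 + B * (τ ^ (-(1 / 2 : ℝ)) * S τ) with hg
  have hScont : ContinuousOn S (Icc t₁ t₂) := h.continuousOn_scaleSeries hs ht₁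
  have hpow : ContinuousOn (fun τ : ℝ => τ ^ (-(1 / 2 : ℝ))) (Icc t₁ t₂) :=
    ContinuousOn.rpow_const continuousOn_id fun τ hτ => Or.inl (ht₁.trans_le hτ.1).ne'
  have hgcont : ContinuousOn g (Icc t₁ t₂) :=
    (continuousOn_const.mul (hScont.pow 2)).add (continuousOn_const.mul (hpow.mul hScont))
  -- pointwise domination on `(t₁, t₂]`
  have hdom : ∀ τ ∈ Ioc t₁ t₂,
      (eSupNorm (I.vSched s τ)).toReal ^ 2 + τ ^ (-(1 / 2 : ℝ)) * (eSupNorm (I.vSched s τ)).toReal ≤ g τ := by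
    intro τ hτ
    have hτ0 : 0 < τ := ht₁.trans hτ.1
    have hle := h.toReal_eSupNorm_vSched_le hs hτ0
    have h0 : 0 ≤ (eSupNorm (I.vSched s τ)).toReal := ENNReal.toReal_nonneg
    have hp : 0 ≤ τ ^ (-(1 / 2 : ℝ)) := Real.rpow_nonneg hτ0.le _
    have h1 : (eSupNorm (I.vSched s τ)).toReal ^ 2 ≤ B ^ 2 * S τ ^ 2 := by
      rw [← mul_pow]; exact pow_le_pow_left₀ h0 hle 2
    have h2 : τ ^ (-(1 / 2 : ℝ)) * (eSupNorm (I.vSched s τ)).toReal ≤ B * (τ ^ (-(1 / 2 : ℝ)) * S τ) := by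
      calc τ ^ (-(1 / 2 : ℝ)) * (eSupNorm (I.vSched s τ)).toReal ≤ τ ^ (-(1 / 2 : ℝ)) * (B * S τ) :=
            mul_le_mul_of_nonneg_left hle hp
        _ = B * (τ ^ (-(1 / 2 : ℝ)) * S τ) := by ring
    exact add_le_add h1 h2
  have hnonneg : ∀ τ ∈ Ioc t₁ t₂,
      0 ≤ (eSupNorm (I.vSched s τ)).toReal ^ 2 + τ ^ (-(1 / 2 : ℝ)) * (eSupNorm (I.vSched s τ)).toReal := by
    intro τ hτ
    have hτ0 : 0 < τ := ht₁.trans hτ.1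
    have h0 : 0 ≤ (eSupNorm (I.vSched s τ)).toReal := ENNReal.toReal_nonneg
    have hp : 0 ≤ τ ^ (-(1 / 2 : ℝ)) := Real.rpow_nonneg hτ0.le _
    positivity
  -- compare the integrals over `Ioc t₁ t₂`
  have hmono : ∫ τ in t₁..t₂, ((eSupNorm (I.vSched s τ)).toReal ^ 2 +
      τ ^ (-(1 / 2 : ℝ)) * (eSupNorm (I.vSched s τ)).toReal) ≤ ∫ τ in t₁..t₂, g τ := by
    rw [intervalIntegral.integral_of_le h12, intervalIntegral.integral_of_le h12]
    refine integral_mono_of_nonneg ?_ ?_ ?_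
    · exact (ae_restrict_iff' measurableSet_Ioc).2 (Eventually.of_forall hnonneg)
    · exact (hgcont.integrableOn_Icc.mono_set Ioc_subset_Icc_self)
    · exact (ae_restrict_iff' measurableSet_Ioc).2 (Eventually.of_forall hdom)
  -- evaluate `∫ g`
  have hiS2 : IntervalIntegrable (fun τ => S τ ^ 2) volume t₁ t₂ := (hScont.pow 2).intervalIntegrable_of_Icc h12
  have hiPS : IntervalIntegrable (fun τ => τ ^ (-(1 / 2 : ℝ)) * S τ) volume t₁ t₂ :=
    (hpow.mul hScont).intervalIntegrable_of_Icc h12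
  have hgint : ∫ τ in t₁..t₂, g τ =
      B ^ 2 * (∫ τ in t₁..t₂, S τ ^ 2) + B * (∫ τ in t₁..t₂, τ ^ (-(1 / 2 : ℝ)) * S τ) := by
    rw [hg, intervalIntegral.integral_add (hiS2.const_mul _) (hiPS.const_mul _),
      intervalIntegral.integral_const_mul, intervalIntegral.integral_const_mul]
  have hI1 := h.integral_scaleSeries_sq_le hs ht₁ h12
  have hI2 := h.integral_rpow_mul_scaleSeries_le hs ht₁ h12
  have hX : 0 ≤ Real.log (t₂ / t₁) / Real.log I.ρ :=
    div_nonneg (Real.log_nonneg ((one_le_div ht₁).2 h12)) h.log_ρ_pos.le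
  have hc : (0 : ℝ) < 4 * Real.pi ^ 2 := four_pi_sq_pos
  have hC1 := lacSqC_spec.1
  have hC2 := lacSqC_spec.2.1
  refine hmono.trans ?_
  rw [hgint]
  calc B ^ 2 * (∫ τ in t₁..t₂, S τ ^ 2) + B * (∫ τ in t₁..t₂, τ ^ (-(1 / 2 : ℝ)) * S τ)
      ≤ B ^ 2 * (lacSqC₁ + lacSqC₂ * (Real.log (t₂ / t₁) / Real.log I.ρ)) +
          B * (6 + 1 / (4 * Real.pi ^ 2) + 1 / (4 * Real.pi ^ 2) ^ 2 +
            (1 + 1 / (2 * (4 * Real.pi ^ 2))) * (Real.log (t₂ / t₁) / Real.log I.ρ)) :=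
        add_le_add (mul_le_mul_of_nonneg_left hI1 (by positivity)) (mul_le_mul_of_nonneg_left hI2 hB0)
    _ ≤ I.cst.Clac * (1 + (Real.log I.ρ)⁻¹ * Real.log (t₂ / t₁)) := by
        have hX' : Real.log (t₂ / t₁) / Real.log I.ρ = (Real.log I.ρ)⁻¹ * Real.log (t₂ / t₁) := by
          rw [div_eq_inv_mul]
        rw [← hX']
        set X := Real.log (t₂ / t₁) / Real.log I.ρ
        set c₆ : ℝ := 6 + 1 / (4 * Real.pi ^ 2) + 1 / (4 * Real.pi ^ 2) ^ 2 with hc₆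
        set c₇ : ℝ := 1 + 1 / (2 * (4 * Real.pi ^ 2)) with hc₇
        have hc₆0 : 0 ≤ c₆ := by positivity
        have hc₇0 : 0 ≤ c₇ := by positivity
        have hClac : I.cst.Clac = B ^ 2 * (lacSqC₁ + lacSqC₂) + B * (c₆ + c₇) := rfl
        rw [hClac]
        have hB2 : 0 ≤ B ^ 2 := sq_nonneg _
        have hdiff : (B ^ 2 * (lacSqC₁ + lacSqC₂) + B * (c₆ + c₇)) * (1 + X) -
            (B ^ 2 * (lacSqC₁ + lacSqC₂ * X) + B * (c₆ + c₇ * X)) =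
            B ^ 2 * lacSqC₂ + B * c₇ + B ^ 2 * lacSqC₁ * X + B * c₆ * X := by ring
        have h1 : 0 ≤ B ^ 2 * lacSqC₂ := mul_nonneg hB2 hC2
        have h2 : 0 ≤ B * c₇ := mul_nonneg hB0 hc₇0
        have h3 : 0 ≤ B ^ 2 * lacSqC₁ * X := mul_nonneg (mul_nonneg hB2 hC1) hX
        have h4 : 0 ≤ B * c₆ * X := mul_nonneg (mul_nonneg hB0 hc₆0) hX
        linarith

end Lacunary

end Admissible

end IterData

end CP25

end Literature.Analysis.FluidPDE
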